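import Summits.CriticalPhenomena.PercolationContinuityZ3.Theorems.Transplant.FKConnectivityAllQAntipodalOddConeEngine
import Summits.CriticalPhenomena.PercolationContinuityZ3.Theorems.Transplant.FKConnectivityAllQAntipodalOddConeTable4

/-!
# Connectivity correlation inequalities for `φ_{w,q}`, every `q > 0` — file 64f: **THE LEVEL-4 REDUCTION** (every increasing `f` of four edges
# ⟸ the 23 rays)

Support file (`--supports stmt-CriticalPhenomena-4575`), FK sub-lane `prim-bschramm-fk-2` (gen 29); builds on p205010 (kernel theorem,
internal audit signed; external expert review pending).  No definitions, no named facts, no sorries; standard axioms.  Memo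
FROM-fk-2-g29-BRIDGE.md §14.

Files 64a (`FK.OddCone` engine: layer cake + cone transfer) and 64b (the level-4 odd-cone table, `FK.OddCone.oddCone4_cert`) combined:
for four distinct edges `x, y, z, w` (`S = {x,y,z,w} ⊆ M'`, `S ∩ C = ∅`), ANY antipodal sum `Σ_{γ ⊆ M', p γ} (f(γ∪C) − f((M'\γ)∪C))·G γ` is `≤ 0`
for EVERY `f` reading only `S` and increasing on its patterns, as soon as it is `≤ 0` for the 23 ray functions `FK.OddCone.ray4 r x y z w`
(4 dictators, 5 `AND`, 4 `maj₃`, 6 `T1`, 4 `T2`) — `sum_antipodal_nonpos_of_rays4`.  In the FK setting (`M' = {x,y,z,w} ∪ M`, `p γ = (k(γ∪C) +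
k((M'\γ)∪C) ≤ J)`, `G γ = g(γ∪C) − g((M'\γ)∪C)`) the ray inequalities are Theorem U (`FK.apPsiC_levels_le_pivot_nonpos_of_isTTSP`), `AND⁺` at any
position (64c `FK.apPsiC_levels_le_andSet_nonpos_of_isTTSP`), `maj₃⁺` (61z / 64d), `T1⁺` (63f / 64e) and `T2⁺` (open): `C_∞⁺` at level 4 is
exactly `T2⁺` away.
[cite: Grimmett2006, §3.8 Thm. (3.90) (pp. 61–62); §3.9 (pp. 63–64)]
-/

noncomputable section

namespace Summit.CriticalPhenomena.PercolationContinuityZ3.Theorems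

namespace FK

namespace OddCone

open Finset

variable {α : Type*} [DecidableEq α]

/-- **THE LEVEL-4 REDUCTION.**  `x, y, z, w` distinct, `S = {x,y,z,w} ⊆ M'`, `S ∩ C = ∅`; `f` reads only `S` and is increasing on the subsets of
`S`.  If the antipodal sum is `≤ 0` for each of the 23 ray functions `ray4 r x y z w`, it is `≤ 0` for `f`.
Proof: layer cake (`sum_antipodal_nonpos_of_thresholds`) ⇒ threshold indicators `1{t ≤ f}`, which are `{0,1}`-valued and monotone on the patterns
⇒ `oddCone4_cert` ⇒ cone transfer (`sum_antipodal_nonpos_of_cone`). [folklore] -/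
theorem sum_antipodal_nonpos_of_rays4 {x y z w : α} (hxy : x ≠ y) (hxz : x ≠ z) (hxw : x ≠ w) (hyz : y ≠ z) (hyw : y ≠ w)
    (hzw : z ≠ w) {M' C : Finset α} (hSM : ({x, y, z, w} : Finset α) ⊆ M') (hSC : Disjoint ({x, y, z, w} : Finset α) C)
    (p : Finset α → Prop) [DecidablePred p] (G : Finset α → ℝ) {f : Finset α → ℝ}
    (hf : ∀ A B : Finset α, (∀ e ∈ ({x, y, z, w} : Finset α), (e ∈ A ↔ e ∈ B)) → f A = f B)
    (hfm : ∀ P Q : Finset α, P ⊆ Q → Q ⊆ ({x, y, z, w} : Finset α) → f P ≤ f Q)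
    (hray : ∀ r : Fin 23,
      ∑ γ ∈ M'.powerset with p γ, (ray4 r x y z w (γ ∪ C) - ray4 r x y z w (M' \ γ ∪ C)) * G γ ≤ 0) :
    ∑ γ ∈ M'.powerset with p γ, (f (γ ∪ C) - f (M' \ γ ∪ C)) * G γ ≤ 0 := by
  refine sum_antipodal_nonpos_of_thresholds hSM hSC p G hf fun t => ?_
  -- the threshold indicator `b = 1{t ≤ f}`: reads `S`, `{0,1}`-valued, monotone on the patterns
  have hb : ∀ A B : Finset α, (∀ e ∈ ({x, y, z, w} : Finset α), (e ∈ A ↔ e ∈ B)) →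
      (fun A : Finset α => if t ≤ f A then (1 : ℝ) else 0) A = (fun A : Finset α => if t ≤ f A then (1 : ℝ) else 0) B := by
    intro A B h
    show (if t ≤ f A then (1 : ℝ) else 0) = if t ≤ f B then 1 else 0
    rw [hf A B h]
  have hb01 : ∀ P : Finset α, P ⊆ ({x, y, z, w} : Finset α) →
      (fun A : Finset α => if t ≤ f A then (1 : ℝ) else 0) P = 0 ∨ (fun A : Finset α => if t ≤ f A then (1 : ℝ) else 0) P = 1 := by
    intro P _
    show (if t ≤ f P then (1 : ℝ) else 0) = 0 ∨ (if t ≤ f P then (1 : ℝ) else 0) = 1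
    by_cases h : t ≤ f P
    · exact Or.inr (if_pos h)
    · exact Or.inl (if_neg h)
  have hbm : ∀ P Q : Finset α, P ⊆ Q → Q ⊆ ({x, y, z, w} : Finset α) →
      (fun A : Finset α => if t ≤ f A then (1 : ℝ) else 0) P ≤ (fun A : Finset α => if t ≤ f A then (1 : ℝ) else 0) Q := by
    intro P Q hPQ hQ
    show (if t ≤ f P then (1 : ℝ) else 0) ≤ if t ≤ f Q then 1 else 0
    have hPQ' := hfm P Q hPQ hQ
    by_cases hP : t ≤ f P
    · rw [if_pos hP, if_pos (hP.trans hPQ')]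
    · rw [if_neg hP]
      split_ifs
      · exact zero_le_one
      · exact le_rfl
  obtain ⟨c, hc, hdec⟩ := oddCone4_cert hxy hxz hxw hyz hyw hzw (fun A : Finset α => if t ≤ f A then (1 : ℝ) else 0) hb01 hbm
  exact sum_antipodal_nonpos_of_cone hSM hSC p G Finset.univ c (fun r _ => hc r) (fun r => ray4 r x y z w) hb
    (fun r _ => ray4_reads r x y z w) (fun P hP => hdec P hP) (fun r _ => hray r)

end OddCone

end FK

end Summit.CriticalPhenomena.PercolationContinuityZ3.Theorems
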